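import Summits.HodgeConjecture.HodgeConjecture.Theorems.F0P3cStCharTSCartanAllH     -- ★ p852410 (H1) «CARTAN-ALL-H»: `exists_cartanAllH` (this lineage, g26)
import HarnessLib

/-!
# F0 · P3c · ROAD «UP-TR» (H1′) — «CARTAN-ALL-H★, ALL SHAPES ON ONE FINSET» [Rogawski1990, §3.6 pp. 28–31; §12.5 pp. 182–184]

Cell `pub/hodgecm-mathlib`, crux H413 = `stmt-HodgeConjecture-24833` (lane `--supports … --as helper`), route HCCMUnconditional; ROAD «UP-TR» (LEAD F0P3a-plan (g15) T14-21 «A»,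
holder ∕ dealer F0P3-p02 (g23)), rider to brick (H1) «CARTAN-ALL-H» ★ p852410 for the (A1′) assembly FILE F (pen LH10-p01 (g8), F PLAN 19:44:06Z); seat F0P3a-p03 (g27).
THEOREMS ONLY (no definition ∕ instance ∕ notation ∕ named fact ∕ `sorry`); ★-only imports.

WHAT.  ★ `F0P3cStCharTSCartanAllH` ships the family of representatives of the conjugacy classes of Cartan subgroups of `H_v = U(Φ₂)(L⁺_v) × U(Φ₁)(L⁺_v)` in THREE letterings,
each behind its own `∃ cartanAllH`: `exists_cartanAllH` (subgroup letters: `Z_H(γ) = Ad(u) T`, conjugate members equal), `exists_cartanAllH_weylShape` (the (H5) WIF-H letters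
`∀ g, g ∈ Z_H(γ) ↔ x⁻¹ g x ∈ T`, `T ≠ T' → ∀ y, ¬ ∀ h, h ∈ T' ↔ y⁻¹ h y ∈ T`) and `exists_cartanAllH_classShape` (the (N5)∕(P3) element letters `hcomplete`, `hirred`).
The (A1′) assembly consumes the (P3) CLAIM-P head (element letters) AND the (H5)∕(H6b′) Weyl-integration heads (WIF letters) on THE SAME finite set `SH` — so it needs the
seven clauses SIMULTANEOUSLY on one witness.  **`exists_cartanAllH_allShapes`**: one `Finset` carrying (1) `M_H ∈ SH`, (2) `hZ`, (3) `hcpt`, (4) `hcov` (subgroup letters),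
(4′) `hcovW` (WIF letters), (4″) `hcomplete` (element letters), (5) `hirr` (subgroup letters), (5′) `hnc` (WIF letters), (5″) `hirred` (element letters).
PROOF = one `obtain` on ★ `exists_cartanAllH` and the rewrites of ★ `_weylShape` ∕ ★ `_classShape` replayed on that witness (★ (H3b) `centralizer_eq_of_mem_centralizer_of_isLocalGRegular`,
★ `isLocalGRegular_of_isConj`, ★ `centralizer_singleton_conj_eq_map`).
HONEST LABEL: count-neutral; block consequents 11 → 10 → 9 only at the rider editions; organs 2 = 2; h413 registry untouched; HC_CM is proved only modulo the printed
citations until rung 0 closes.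

## References
* [Rogawski1990] J. D. Rogawski, *Automorphic Representations of Unitary Groups in Three Variables*, Ann. of Math. Stud. 123 (1990): §3.6 pp. 28–31 (Cartan subgroups of
  `U(2) × U(1)`), §12.5 pp. 182–184 («a set of representatives for the conjugacy classes of Cartan subgroups» of `H`; proof of Lemma 12.5.1).
-/

set_option autoImplicit false
-- the mandated namespace has the single-problem summit's repeated segment (`HodgeConjecture.HodgeConjecture`)
set_option linter.dupNamespace false

noncomputable section

open NumberField IsDedekindDomain
open scoped Matrix MatrixGroups
open Literature.NumberTheory.Rogawski1990 Literature.NumberTheory.Automorphic Literature.NumberTheory.Automorphic.UnitaryGroup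
open Summit.HodgeConjecture.HodgeConjecture.Cruxes.H413.F0P3cStCharTSCartanAllH (exists_cartanAllH)

namespace Summit.HodgeConjecture.HodgeConjecture.Cruxes.H413.F0P3cStCharTSCartanAllHShapes

variable (L : Type) [Field L] [NumberField L] [IsCMField L] (v : HeightOneSpectrum (𝓞 ↥(maximalRealSubfield L)))

set_option maxHeartbeats 800000 in  -- statement-level `whnf` on the CM carriers, as in ★ CartanAllH ∕ CartanFinTwo
/-- **«CARTAN-ALL-H★, ALL SHAPES»** — ONE finite set `SH` of subgroups of `H_v = U(Φ₂)(L⁺_v) × U(Φ₁)(L⁺_v)` (`v` non-split) carrying every lettering of the Cartan-representative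
package at once: (1) the split torus `M_H = M₂ × U(Φ₁)(L⁺_v)` is a member; (2) `hZ` every member is `Z_H(γ₀)` with `γ₀` `G`-regular; (3) `hcpt` every member `≠ M_H` is compact;
(4) `hcov` the centraliser of every `G`-regular `γ` is `Ad(u) T` for a member `T`; (4′) `hcovW` the same in Weyl-integration letters `∀ g, g ∈ Z_H(γ) ↔ x⁻¹ g x ∈ T`;
(4″) `hcomplete` every `G`-regular `h` is conjugate to an element of a member; (5) `hirr` conjugate members are equal; (5′) `hnc` distinct members are not conjugate, in
Weyl-integration letters; (5″) `hirred` two members containing conjugate `G`-regular elements are equal.  All three ★ letterings of ★ `F0P3cStCharTSCartanAllH` on the SAME witness,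
so that the (P3) CLAIM-P head and the (H5)∕(H6b′) Weyl-integration heads may be instantiated at one `SH`. [cite: Rogawski1990, §12.5 pp. 182–183; §3.6 pp. 28–31] -/
theorem exists_cartanAllH_allShapes (hns : ∀ w : PlacesOver L v, IsCMField.complexConj L • w.1 = w.1) :
    ∃ cartanAllH : Finset (Subgroup ((UnitaryGroup.cmDatum L 2 (Matrix.of fun i j : Fin 2 => if i.val + j.val + 1 = 2 then (1 : L) else 0)).Local v ×
        (UnitaryGroup.cmDatum L 1 (Matrix.of fun i j : Fin 1 => if i.val + j.val + 1 = 1 then (1 : L) else 0)).Local v)),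
      -- (1) the split torus is a member
      ((cmBorelTriple L 2 v).M).prod ⊤ ∈ cartanAllH ∧
      -- (2) `hZ`
      (∀ T ∈ cartanAllH, ∃ γ₀ : (UnitaryGroup.cmDatum L 2 (Matrix.of fun i j : Fin 2 => if i.val + j.val + 1 = 2 then (1 : L) else 0)).Local v ×
          (UnitaryGroup.cmDatum L 1 (Matrix.of fun i j : Fin 1 => if i.val + j.val + 1 = 1 then (1 : L) else 0)).Local v,
        IsLocalGRegular L v γ₀ ∧ T = Subgroup.centralizer ({γ₀} : Set ((UnitaryGroup.cmDatum L 2 (Matrix.of fun i j : Fin 2 => if i.val + j.val + 1 = 2 then (1 : L) else 0)).Local v ×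
          (UnitaryGroup.cmDatum L 1 (Matrix.of fun i j : Fin 1 => if i.val + j.val + 1 = 1 then (1 : L) else 0)).Local v))) ∧
      -- (3) `hcpt`
      (∀ T ∈ cartanAllH, T ≠ ((cmBorelTriple L 2 v).M).prod ⊤ →
        IsCompact (T : Set ((UnitaryGroup.cmDatum L 2 (Matrix.of fun i j : Fin 2 => if i.val + j.val + 1 = 2 then (1 : L) else 0)).Local v ×
          (UnitaryGroup.cmDatum L 1 (Matrix.of fun i j : Fin 1 => if i.val + j.val + 1 = 1 then (1 : L) else 0)).Local v))) ∧
      -- (4) `hcov` (subgroup letters)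
      (∀ γ : (UnitaryGroup.cmDatum L 2 (Matrix.of fun i j : Fin 2 => if i.val + j.val + 1 = 2 then (1 : L) else 0)).Local v ×
          (UnitaryGroup.cmDatum L 1 (Matrix.of fun i j : Fin 1 => if i.val + j.val + 1 = 1 then (1 : L) else 0)).Local v,
        IsLocalGRegular L v γ →
        ∃ T ∈ cartanAllH, ∃ u : (UnitaryGroup.cmDatum L 2 (Matrix.of fun i j : Fin 2 => if i.val + j.val + 1 = 2 then (1 : L) else 0)).Local v ×
            (UnitaryGroup.cmDatum L 1 (Matrix.of fun i j : Fin 1 => if i.val + j.val + 1 = 1 then (1 : L) else 0)).Local v,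
          Subgroup.centralizer ({γ} : Set ((UnitaryGroup.cmDatum L 2 (Matrix.of fun i j : Fin 2 => if i.val + j.val + 1 = 2 then (1 : L) else 0)).Local v ×
            (UnitaryGroup.cmDatum L 1 (Matrix.of fun i j : Fin 1 => if i.val + j.val + 1 = 1 then (1 : L) else 0)).Local v)) = T.map (MulAut.conj u).toMonoidHom) ∧
      -- (4′) `hcovW` (Weyl-integration letters)
      (∀ γ : (UnitaryGroup.cmDatum L 2 (Matrix.of fun i j : Fin 2 => if i.val + j.val + 1 = 2 then (1 : L) else 0)).Local v ×
          (UnitaryGroup.cmDatum L 1 (Matrix.of fun i j : Fin 1 => if i.val + j.val + 1 = 1 then (1 : L) else 0)).Local v,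
        IsLocalGRegular L v γ →
        ∃ T ∈ cartanAllH, ∃ x : (UnitaryGroup.cmDatum L 2 (Matrix.of fun i j : Fin 2 => if i.val + j.val + 1 = 2 then (1 : L) else 0)).Local v ×
            (UnitaryGroup.cmDatum L 1 (Matrix.of fun i j : Fin 1 => if i.val + j.val + 1 = 1 then (1 : L) else 0)).Local v,
          ∀ g : (UnitaryGroup.cmDatum L 2 (Matrix.of fun i j : Fin 2 => if i.val + j.val + 1 = 2 then (1 : L) else 0)).Local v ×
              (UnitaryGroup.cmDatum L 1 (Matrix.of fun i j : Fin 1 => if i.val + j.val + 1 = 1 then (1 : L) else 0)).Local v,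
            g ∈ Subgroup.centralizer ({γ} : Set ((UnitaryGroup.cmDatum L 2 (Matrix.of fun i j : Fin 2 => if i.val + j.val + 1 = 2 then (1 : L) else 0)).Local v ×
              (UnitaryGroup.cmDatum L 1 (Matrix.of fun i j : Fin 1 => if i.val + j.val + 1 = 1 then (1 : L) else 0)).Local v)) ↔ x⁻¹ * g * x ∈ T) ∧
      -- (4″) `hcomplete` (element letters)
      (∀ h : (UnitaryGroup.cmDatum L 2 (Matrix.of fun i j : Fin 2 => if i.val + j.val + 1 = 2 then (1 : L) else 0)).Local v ×
          (UnitaryGroup.cmDatum L 1 (Matrix.of fun i j : Fin 1 => if i.val + j.val + 1 = 1 then (1 : L) else 0)).Local v,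
        IsLocalGRegular L v h → ∃ T ∈ cartanAllH, ∃ s ∈ T, IsConj h s) ∧
      -- (5) `hirr` (subgroup letters)
      (∀ T ∈ cartanAllH, ∀ T' ∈ cartanAllH,
        (∃ x : (UnitaryGroup.cmDatum L 2 (Matrix.of fun i j : Fin 2 => if i.val + j.val + 1 = 2 then (1 : L) else 0)).Local v ×
            (UnitaryGroup.cmDatum L 1 (Matrix.of fun i j : Fin 1 => if i.val + j.val + 1 = 1 then (1 : L) else 0)).Local v,
          T.map (MulAut.conj x).toMonoidHom = T') → T = T') ∧
      -- (5′) `hnc` (Weyl-integration letters)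
      (∀ T ∈ cartanAllH, ∀ T' ∈ cartanAllH, T ≠ T' → ∀ y : (UnitaryGroup.cmDatum L 2 (Matrix.of fun i j : Fin 2 => if i.val + j.val + 1 = 2 then (1 : L) else 0)).Local v ×
          (UnitaryGroup.cmDatum L 1 (Matrix.of fun i j : Fin 1 => if i.val + j.val + 1 = 1 then (1 : L) else 0)).Local v,
        ¬ ∀ h : (UnitaryGroup.cmDatum L 2 (Matrix.of fun i j : Fin 2 => if i.val + j.val + 1 = 2 then (1 : L) else 0)).Local v ×
            (UnitaryGroup.cmDatum L 1 (Matrix.of fun i j : Fin 1 => if i.val + j.val + 1 = 1 then (1 : L) else 0)).Local v,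
          h ∈ T' ↔ y⁻¹ * h * y ∈ T) ∧
      -- (5″) `hirred` (element letters)
      (∀ T ∈ cartanAllH, ∀ T' ∈ cartanAllH, ∀ s ∈ T, ∀ s' ∈ T', IsLocalGRegular L v s → IsConj s s' → T = T') := by
  obtain ⟨C, hM, hZ, hcpt, hcov, hirr⟩ := exists_cartanAllH L v hns
  refine ⟨C, hM, hZ, hcpt, hcov, fun γ hreg => ?_, fun h hreg => ?_, hirr, fun T hT T' hT' hne y hy => hne (hirr T hT T' hT' ⟨y, ?_⟩),
    fun T hT T' hT' s hs s' hs' hsreg hconj => ?_⟩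
  · -- (4′): `Z_H(γ) = Ad(u) T` in membership letters
    obtain ⟨T, hT, u, hu⟩ := hcov γ hreg
    refine ⟨T, hT, u, fun g => ?_⟩
    rw [hu, Subgroup.mem_map_equiv, MulAut.conj_symm_apply]
  · -- (4″): `h ∈ Z_H(h) = Ad(u) T`, so `u⁻¹ h u ∈ T` is conjugate to `h`
    obtain ⟨T, hT, u, hu⟩ := hcov h hreg
    have hh : h ∈ Subgroup.centralizer ({h} : Set ((UnitaryGroup.cmDatum L 2 (Matrix.of fun i j : Fin 2 => if i.val + j.val + 1 = 2 then (1 : L) else 0)).Local v ×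
        (UnitaryGroup.cmDatum L 1 (Matrix.of fun i j : Fin 1 => if i.val + j.val + 1 = 1 then (1 : L) else 0)).Local v)) := Subgroup.mem_centralizer_singleton_iff.2 rfl
    rw [hu, Subgroup.mem_map_equiv, MulAut.conj_symm_apply] at hh
    exact ⟨T, hT, u⁻¹ * h * u, hh, isConj_iff.2 ⟨u⁻¹, by group⟩⟩
  · -- (5′): a membership-lettered conjugacy is `T.map (conj y) = T'`
    ext h
    rw [Subgroup.mem_map_equiv, MulAut.conj_symm_apply]
    exact (hy h).symm
  · -- (5″): `Z_H(s) = Z_H(γ₀) = T`, `Z_H(c s c⁻¹) = Z_H(γ₀') = T'`, `Z_H(c s c⁻¹) = Ad(c) Z_H(s)`, then (5)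
    obtain ⟨γ₀, hγ₀, rfl⟩ := hZ T hT
    obtain ⟨γ₀', hγ₀', rfl⟩ := hZ T' hT'
    obtain ⟨c, rfl⟩ := isConj_iff.1 hconj
    have hs'reg : IsLocalGRegular L v (c * s * c⁻¹) := isLocalGRegular_of_isConj (L := L) hconj hsreg
    have h1 := F0P3cStCharTSUpTrCartanFields.centralizer_eq_of_mem_centralizer_of_isLocalGRegular L v hγ₀ hs hsreg
    have h2 := F0P3cStCharTSUpTrCartanFields.centralizer_eq_of_mem_centralizer_of_isLocalGRegular L v hγ₀' hs' hs'reg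
    refine hirr _ hT _ hT' ⟨c, ?_⟩
    rw [← h1, ← h2, F0P3cStCharTSCartanEllProd.centralizer_singleton_conj_eq_map]

end Summit.HodgeConjecture.HodgeConjecture.Cruxes.H413.F0P3cStCharTSCartanAllHShapes

end
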